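import Summits.SmoothPoincare4.SmoothPoincare4.Theorems.CongruenceShadowsNormalFormStablyTrivialLuftStubMovesGoeritzAux
import Mathlib.Tactic.Group

/-!
# Stub `stub_movesGoeritz` of line `luft-twist-reduction` for crux `NormalFormStablyTrivial`
# (item stmt-SmoothPoincare4-14591, route `CongruenceShadows`) — auxiliary file 4: the corrected
# handle slide of `k` over the knob `l` (Goeritz realisation of a right transvection)

In the `a`-normalisation of `…LuftStubMovesGoeritzAux.lean` (cut system `{aᵢ}` with erasure
`eraseA : aᵢ ↦ 1, bᵢ ↦ xᵢ`, and a second cut system `cutKernel d`, `d i = true` on the TRIVIAL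
handles) this file realises the RIGHT TRANSVECTION `xᵢ ↦ xᵢ x_t` BY a trivial letter `x_t`
(`d t = true`) of the letter `xᵢ` of another handle of either type, for `t = l`,
`i = k`, `k < l`, by an explicit automorphism of `S_g` moving only the handles `k`, `l`,
stabilising `cutKernel d` (and `⟪aᵢ⟫`) and inducing the move ON THE NOSE through `eraseA`:

* `exists_slideTransvLt` — the handle slide `slideEquiv (k < l)` of `SurfaceGroupHandleMoves.lean` (which
  induces `β_{kl} : x_k ↦ x_k x_l` on `F_g = S_g ⧸ ⟪aᵢ⟫` and stabilises `⟪aᵢ⟫`, but NOT the second cut kernel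
  when the handle `k` is trivial) PRECOMPOSED with the meridian transvection
  `b_k ↦ b_k a_k` (`transvEquiv k 1`, inducing the identity): the automorphism with
  the displayed two-handle generator images (`m = mid k l`; relator fixed on the nose, inverse
  images displayed), written out so that all checks are identities between short words;
* `helper_movesGoeritz_4` (registered helper) — for every cut pattern `d` with `d l = true` the corrected
  slide stabilises `cutKernel d` (two-handle erasure test `map_cutKernel_eq_of_block`) and
  induces `nielsenBeta k l : x_k ↦ x_k x_l` (`eraseA_apply_eq_of_block`).

Geometrically: a handle slide of the middle handlebody over a stabilising (cancelling) handle
extends over the other handlebody after one meridian twist; only the algebra is formalised.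
-/

-- the prescribed namespace `Summit.<P>.<Sub>.…` duplicates `SmoothPoincare4` (P = Sub)
set_option linter.dupNamespace false

noncomputable section

namespace Summit.SmoothPoincare4.SmoothPoincare4.Theorems.NormalFormStablyTrivial.Luft

open Literature.Topology.FourManifolds Literature.Topology.FourManifolds.SurfaceGroup
open Literature.GroupTheory.CombinatorialGroupTheory Subgroup

/-! ## §1 The corrected slide of handle `k` over the knob `l` (`k < l`) -/

/-- **The corrected handle slide `slide_{kl} ∘ transv_k(1)`** (`k < l`): an automorphism of `S_g` moving
only the handles `k`, `l`, with the displayed generator images (the slide words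
`HandleWords.slideA/C/D` on `a_k, a_l, b_l` and `slideB · slideA` on `b_k`) and inverse generator
images. [folklore] -/
theorem exists_slideTransvLt {g : ℕ} {k l : Fin g} (hkl : k < l) :
    ∃ y : SurfaceGroup g ≃* SurfaceGroup g,
      (∀ p, y (PresentedGroup.of p) = blockGens k l
        (a k * mid k l * (b l)⁻¹ * (mid k l)⁻¹ * a k * mid k l * b l * (mid k l)⁻¹ * (a k)⁻¹)
        (a k * mid k l * (b l)⁻¹ * (mid k l)⁻¹ * (a k)⁻¹ * mid k l * b l * (mid k l)⁻¹ * b k *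
          a k * mid k l * b l * (mid k l)⁻¹ * (a k)⁻¹)
        ((mid k l)⁻¹ * a k * mid k l * (b l)⁻¹ * (mid k l)⁻¹ * (a k)⁻¹ * mid k l * b l * a l *
          (mid k l)⁻¹ * (a k)⁻¹ * mid k l)
        ((mid k l)⁻¹ * a k * mid k l * b l * (mid k l)⁻¹ * (a k)⁻¹ * mid k l) p) ∧
      (∀ p, y.symm (PresentedGroup.of p) = blockGens k l
        (mid k l * b l * (mid k l)⁻¹ * a k * mid k l * (b l)⁻¹ * (mid k l)⁻¹)
        (mid k l * b l * (mid k l)⁻¹ * (a k)⁻¹ * mid k l * (b l)⁻¹ * (mid k l)⁻¹ * a k * b k *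
          mid k l * (b l)⁻¹ * (mid k l)⁻¹)
        (b l * (mid k l)⁻¹ * (a k)⁻¹ * mid k l * (b l)⁻¹ * (mid k l)⁻¹ * a k * mid k l * a l *
          b l * (mid k l)⁻¹ * a k * mid k l * (b l)⁻¹)
        (b l * (mid k l)⁻¹ * (a k)⁻¹ * mid k l * b l * (mid k l)⁻¹ * a k * mid k l * (b l)⁻¹) p) := by
  refine ⟨equivOfGens
      (blockGens k l
        (a k * mid k l * (b l)⁻¹ * (mid k l)⁻¹ * a k * mid k l * b l * (mid k l)⁻¹ * (a k)⁻¹)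
        (a k * mid k l * (b l)⁻¹ * (mid k l)⁻¹ * (a k)⁻¹ * mid k l * b l * (mid k l)⁻¹ * b k *
          a k * mid k l * b l * (mid k l)⁻¹ * (a k)⁻¹)
        ((mid k l)⁻¹ * a k * mid k l * (b l)⁻¹ * (mid k l)⁻¹ * (a k)⁻¹ * mid k l * b l * a l *
          (mid k l)⁻¹ * (a k)⁻¹ * mid k l)
        ((mid k l)⁻¹ * a k * mid k l * b l * (mid k l)⁻¹ * (a k)⁻¹ * mid k l))
      (blockGens k l
        (mid k l * b l * (mid k l)⁻¹ * a k * mid k l * (b l)⁻¹ * (mid k l)⁻¹)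
        (mid k l * b l * (mid k l)⁻¹ * (a k)⁻¹ * mid k l * (b l)⁻¹ * (mid k l)⁻¹ * a k * b k *
          mid k l * (b l)⁻¹ * (mid k l)⁻¹)
        (b l * (mid k l)⁻¹ * (a k)⁻¹ * mid k l * (b l)⁻¹ * (mid k l)⁻¹ * a k * mid k l * a l *
          b l * (mid k l)⁻¹ * a k * mid k l * (b l)⁻¹)
        (b l * (mid k l)⁻¹ * (a k)⁻¹ * mid k l * b l * (mid k l)⁻¹ * a k * mid k l * (b l)⁻¹))
      (prod_relFactor_blockGens hkl _ _ _ _ (by group))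
      (prod_relFactor_blockGens hkl _ _ _ _ (by group)) ?_ ?_,
    fun p => equivOfGens_of _ _ _ _ _ _ p, fun p => equivOfGens_symm_of _ _ _ _ _ _ p⟩
  · -- `y⁻¹ ∘ y = id` on the generators
    rintro ⟨i, s⟩
    by_cases hik : i = k
    · subst hik
      cases s
      · rw [← a_def]
        simp only [blockGens_k_false, map_mul, map_inv, homOfGens_a, homOfGens_b,
            blockGens_l_true hkl, homOfGens_blockGens_mid]
        group
      · rw [← b_def]
        simp only [blockGens_k_true, map_mul, map_inv, homOfGens_a, homOfGens_b,
            blockGens_k_false, blockGens_l_true hkl, homOfGens_blockGens_mid]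
        group
    by_cases hil : i = l
    · subst hil
      cases s
      · rw [← a_def]
        simp only [blockGens_l_false hkl, map_mul, map_inv, homOfGens_a, homOfGens_b,
            blockGens_k_false, blockGens_l_true hkl, homOfGens_blockGens_mid]
        group
      · rw [← b_def]
        simp only [blockGens_l_true hkl, map_mul, map_inv, homOfGens_a, homOfGens_b,
            blockGens_k_false, homOfGens_blockGens_mid]
        group
    simp only [homOfGens_of, blockGens_of_ne _ _ _ _ hik hil]
  · -- `y ∘ y⁻¹ = id` on the generators
    rintro ⟨i, s⟩
    by_cases hik : i = k
    · subst hik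
      cases s
      · rw [← a_def]
        simp only [blockGens_k_false, map_mul, map_inv, homOfGens_a, homOfGens_b,
            blockGens_l_true hkl, homOfGens_blockGens_mid]
        group
      · rw [← b_def]
        simp only [blockGens_k_true, map_mul, map_inv, homOfGens_a, homOfGens_b,
            blockGens_k_false, blockGens_l_true hkl, homOfGens_blockGens_mid]
        group
    by_cases hil : i = l
    · subst hil
      cases s
      · rw [← a_def]
        simp only [blockGens_l_false hkl, map_mul, map_inv, homOfGens_a, homOfGens_b,
            blockGens_k_false, blockGens_l_true hkl, homOfGens_blockGens_mid]
        group
      · rw [← b_def]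
        simp only [blockGens_l_true hkl, map_mul, map_inv, homOfGens_a, homOfGens_b,
            blockGens_k_false, homOfGens_blockGens_mid]
        group
    simp only [homOfGens_of, blockGens_of_ne _ _ _ _ hik hil]

/-! ## §2 The corrected slide realises the transvection -/

/-- **Registered helper `helper_movesGoeritz_4` — the corrected slide realises the right transvection by
a LATER trivial letter**: for a cut pattern `d` with `d l = true` (handle `l` trivial, handle `k <
l` of either type) the corrected slide stabilises `cutKernel d` and induces `x_k ↦ x_k x_l` through
`eraseA`. [folklore] -/
theorem helper_movesGoeritz_4 : ∀ (g : ℕ) (k l : Fin g) (hkl : k < l) (d : Fin g → Bool), d l = true → ∃ y : Literature.Topology.FourManifolds.SurfaceGroup g ≃* Literature.Topology.FourManifolds.SurfaceGroup g, (Literature.Topology.FourManifolds.SurfaceGroup.cutKernel d).map y.toMonoidHom = Literature.Topology.FourManifolds.SurfaceGroup.cutKernel d ∧ ∀ s, Literature.Topology.FourManifolds.SurfaceGroup.eraseA (y s) = Literature.GroupTheory.CombinatorialGroupTheory.nielsenBeta k l (ne_of_lt hkl) (Literature.Topology.FourManifolds.SurfaceGroup.eraseA s) := by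
  intro g k l hkl d hd
  obtain ⟨y, hy, hy'⟩ := exists_slideTransvLt hkl
  have hfix : ∀ i, i ≠ k → i ≠ l → ∀ s, y (PresentedGroup.of (i, s)) = PresentedGroup.of (i, s) :=
    fun i hik hil s => by rw [hy, blockGens_of_ne _ _ _ _ hik hil]
  have hAk : y (a k) =
      a k * mid k l * (b l)⁻¹ * (mid k l)⁻¹ * a k * mid k l * b l * (mid k l)⁻¹ * (a k)⁻¹ :=
    (hy (k, false)).trans (blockGens_k_false _ _ _ _)
  have hBk : y (b k) =
      a k * mid k l * (b l)⁻¹ * (mid k l)⁻¹ * (a k)⁻¹ * mid k l * b l * (mid k l)⁻¹ * b k * a k *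
      mid k l * b l * (mid k l)⁻¹ * (a k)⁻¹ :=
    (hy (k, true)).trans (blockGens_k_true _ _ _ _)
  have hAl : y (a l) =
      (mid k l)⁻¹ * a k * mid k l * (b l)⁻¹ * (mid k l)⁻¹ * (a k)⁻¹ * mid k l * b l * a l *
      (mid k l)⁻¹ * (a k)⁻¹ * mid k l :=
    (hy (l, false)).trans (blockGens_l_false hkl _ _ _ _)
  have hBl : y (b l) =
      (mid k l)⁻¹ * a k * mid k l * b l * (mid k l)⁻¹ * (a k)⁻¹ * mid k l :=
    (hy (l, true)).trans (blockGens_l_true hkl _ _ _ _)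
  have hAk' : y.symm (a k) =
      mid k l * b l * (mid k l)⁻¹ * a k * mid k l * (b l)⁻¹ * (mid k l)⁻¹ :=
    (hy' (k, false)).trans (blockGens_k_false _ _ _ _)
  have hBk' : y.symm (b k) =
      mid k l * b l * (mid k l)⁻¹ * (a k)⁻¹ * mid k l * (b l)⁻¹ * (mid k l)⁻¹ * a k * b k *
      mid k l * (b l)⁻¹ * (mid k l)⁻¹ :=
    (hy' (k, true)).trans (blockGens_k_true _ _ _ _)
  have hAl' : y.symm (a l) =
      b l * (mid k l)⁻¹ * (a k)⁻¹ * mid k l * (b l)⁻¹ * (mid k l)⁻¹ * a k * mid k l * a l * b l *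
      (mid k l)⁻¹ * a k * mid k l * (b l)⁻¹ :=
    (hy' (l, false)).trans (blockGens_l_false hkl _ _ _ _)
  have hBl' : y.symm (b l) =
      b l * (mid k l)⁻¹ * (a k)⁻¹ * mid k l * b l * (mid k l)⁻¹ * a k * mid k l * (b l)⁻¹ :=
    (hy' (l, true)).trans (blockGens_l_true hkl _ _ _ _)
  have hθ : ∀ i, i ≠ k → i ≠ l →
      Literature.GroupTheory.CombinatorialGroupTheory.nielsenBeta k l (ne_of_lt hkl) (FreeGroup.of i) = FreeGroup.of i :=
    fun i hik _ => nielsenBeta_of_ne _ hik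
  refine ⟨y, map_cutKernel_eq_of_block y d k l hfix ?_ ?_ ?_ ?_,
    eraseA_apply_eq_of_block y _ k l hfix hθ ?_ ?_ ?_ ?_⟩
  · -- the cut letter of the handle `k` (either type)
    cases hdf : d k
    · rw [← a_def, hAk]
      simp only [map_mul, map_inv, erase_b_of_eq_true d hd, erase_a_of_eq_false d hdf, erase_mid]
      group
    · rw [← b_def, hBk]
      simp only [map_mul, map_inv, erase_b_of_eq_true d hd, erase_a_of_eq_true d hdf,
        erase_b_of_eq_true d hdf, erase_mid]
      group
  · -- the cut letter `b` of the knob `l`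
    rw [hd, ← b_def, hBl]
    cases hdf : d k
    · simp only [map_mul, map_inv, erase_b_of_eq_true d hd, erase_a_of_eq_false d hdf, erase_mid]
      group
    · simp only [map_mul, map_inv, erase_b_of_eq_true d hd, erase_a_of_eq_true d hdf, erase_mid]
      group
  · -- the cut letter of the handle `k` (either type)
    cases hdf : d k
    · rw [← a_def, hAk']
      simp only [map_mul, map_inv, erase_b_of_eq_true d hd, erase_a_of_eq_false d hdf, erase_mid]
      group
    · rw [← b_def, hBk']
      simp only [map_mul, map_inv, erase_b_of_eq_true d hd, erase_a_of_eq_true d hdf,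
        erase_b_of_eq_true d hdf, erase_mid]
      group
  · -- the cut letter `b` of the knob `l`
    rw [hd, ← b_def, hBl']
    cases hdf : d k
    · simp only [map_mul, map_inv, erase_b_of_eq_true d hd, erase_a_of_eq_false d hdf, erase_mid]
      group
    · simp only [map_mul, map_inv, erase_b_of_eq_true d hd, erase_a_of_eq_true d hdf, erase_mid]
      group
  · rw [hAk]
    simp only [map_mul, map_inv, eraseA_a, eraseA_b, eraseA_mid]
    group
  · rw [hAl]
    simp only [map_mul, map_inv, eraseA_a, eraseA_b, eraseA_mid]
    group
  · rw [hBk, nielsenBeta_of_self]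
    simp only [map_mul, map_inv, eraseA_a, eraseA_b, eraseA_mid]
    group
  · rw [hBl, nielsenBeta_of_ne (ne_of_lt hkl) (ne_of_lt hkl).symm]
    simp only [map_mul, map_inv, eraseA_a, eraseA_b, eraseA_mid]
    group

end Summit.SmoothPoincare4.SmoothPoincare4.Theorems.NormalFormStablyTrivial.Luft

end
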